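import Summits.CriticalPhenomena.PercolationContinuityZ3.Theorems.Transplant.TriFilmPaths
import Summits.CriticalPhenomena.PercolationContinuityZ3.Theorems.Transplant.TriClawSound
import HarnessLib

/-!
# Routing in the triangular films — core: planar legs, `RouteData` from two film paths, the hub pieces

builds on p205010 (kernel theorem, internal audit signed; external expert review pending) — NOT used in this file.  Lane `prim-bschramm`, seat
`prim-bschramm-p2` (gen 33; class C1b; memo `HOME/bschramm/P2-LATTICES.md` §121); helper file (`--supports stmt-CriticalPhenomena-4575 --as helper`).
* §1 `TriFilm.Leg R avoid ρ a ℓ` — a planar leg in `Site 2` form (what the template consumes) and its production from the oracle («TriClawSound»):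
  **`TriFilm.exists_legs`**;
* §2 **`TriFilm.routeData_of_paths`**: `HexShadow.RouteData` for the film's shadow from a film path `L : E₁ ⇝ E₂` with a marked edge `c → y` and a film path
  `c ⇝ w'` whose tail misses `L`;
* §3 the hub pieces of the template (`hubY`, `hubB`: centre column between layers `1` and `0/2`, with the ring steps) as `FPath`s;
* §4 auxiliary layers (`lam2`, `fresh`, `adjLayer`), the eight columns `XA … XH` of the exceptional configurations, small explicit paths.
[cite: DuminilCopinSidoraviciusTassion2016, §2.3 (proof of Fact 2)]
-/

noncomputable section

namespace Summit.CriticalPhenomena.PercolationContinuityZ3.Theorems.Transplant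

open Literature.Probability.Percolation Literature.Probability.LatticeModels SimpleGraph
open scoped Classical

namespace TriFilm

open TriClaw

variable {k : ℕ}

/-! ## §1 Planar legs -/

/-- **A planar leg** from the inner-ring point `ρ` to the target `a` inside the column set `R`, avoiding `avoid` and the centre, meeting the inner ring
only at its start (the `Site 2` form of «TriClawSound»'s `LegProps`). [folklore] -/
structure Leg (R : Set (Site 2)) (avoid : Set (Site 2)) (ρ a : Site 2) (ℓ : List (Site 2)) : Prop where
  /-- non-empty -/
  ne_nil : ℓ ≠ []
  /-- starts at `ρ` -/
  head : ℓ.head ne_nil = ρ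
  /-- ends at `a` -/
  last : ℓ.getLast ne_nil = a
  /-- `ρ` is on the inner ring -/
  ring : triNorm ρ = 1
  /-- inside `R` -/
  mem : ∀ q ∈ ℓ, q ∈ R
  /-- avoids the forbidden points -/
  not_avoid : ∀ q ∈ ℓ, q ∉ avoid
  /-- off the centre -/
  ne_zero : ∀ q ∈ ℓ, q ≠ 0
  /-- the inner ring is met only at the start: any inner-ring point of the leg is `ρ` -/
  ring_only : ∀ q ∈ ℓ, triNorm q = 1 → q = ρ
  /-- a `𝕋`-chain -/
  chain : ℓ.IsChain (fun a b => triGraph.Adj a b)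
  /-- self-avoiding -/
  nodup : ℓ.Nodup

namespace Leg

variable {R avoid : Set (Site 2)} {ρ a : Site 2} {ℓ : List (Site 2)} (h : Leg R avoid ρ a ℓ)
include h

/-- `ρ ∈ ℓ`. [folklore] -/
theorem rho_mem : ρ ∈ ℓ := by rw [← h.head]; exact List.head_mem _

/-- `a ∈ ℓ`. [folklore] -/
theorem a_mem : a ∈ ℓ := by rw [← h.last]; exact List.getLast_mem _

/-- `ρ ∈ R`. [folklore] -/
theorem rho_R : ρ ∈ R := h.mem _ h.rho_mem

/-- `a ∈ R`. [folklore] -/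
theorem a_R : a ∈ R := h.mem _ h.a_mem

/-- `ρ ≠ 0`. [folklore] -/
theorem rho_ne_zero : ρ ≠ 0 := h.ne_zero _ h.rho_mem

/-- The lifted leg is a film path from `vx ρ j` to `vx a j`. [folklore] -/
theorem fpath (j : ℕ) (hj : j ≤ k) : FPath k (lay k j ℓ) (vx k ρ j) (vx k a j) := by
  have := fpath_lay (k := k) hj h.ne_nil h.chain h.nodup
  rwa [h.head, h.last] at this

end Leg

/-- From the integer-pair oracle to `Site 2` legs. [folklore] -/
theorem leg_of_legProps {t : ℕ} {avoid : List TriClaw.Pt} {a : TriClaw.Pt} {l : List TriClaw.Pt} (h : TriClaw.LegProps t avoid a l)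
    {R : Set (Site 2)} (hR : ∀ w : TriClaw.Pt, TriClaw.tn w ≤ 3 → w.1 ≤ t → TriClaw.toSite w ∈ R) :
    Leg R {q | ∃ p ∈ avoid, TriClaw.toSite p = q} (TriClaw.toSite (l.head h.ne_nil)) (TriClaw.toSite a) (l.map TriClaw.toSite) := by
  have hne : l.map TriClaw.toSite ≠ [] := by simpa using h.ne_nil
  refine ⟨hne, ?_, ?_, ?_, ?_, ?_, ?_, ?_, ?_, h.nodup.map TriClaw.toSite_injective⟩
  · rw [List.head_map]
  · rw [List.getLast_map, h.last]
  · have := h.head_ring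
    have e := TriClaw.triNorm_toSite (l.head h.ne_nil)
    rw [this] at e; exact_mod_cast e
  · intro q hq
    obtain ⟨w, hw, rfl⟩ := List.mem_map.1 hq
    exact hR w (h.mem_blk w hw).1 (h.mem_blk w hw).2
  · intro q hq ⟨p, hp, hpq⟩
    obtain ⟨w, hw, rfl⟩ := List.mem_map.1 hq
    rw [TriClaw.toSite_injective hpq] at hp
    exact h.not_avoid w hw hp
  · intro q hq h0
    obtain ⟨w, hw, rfl⟩ := List.mem_map.1 hq
    apply h.ne_zero w hw
    apply TriClaw.toSite_injective
    rw [h0]; ext j; fin_cases j <;> rfl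
  · intro q hq h1
    obtain ⟨w, hw, rfl⟩ := List.mem_map.1 hq
    have e := TriClaw.triNorm_toSite w
    rw [h1] at e
    have hw1 : TriClaw.tn w = 1 := by exact_mod_cast e.symm
    -- an inner-ring point of the leg is its head
    obtain ⟨x, xs, hl⟩ := List.exists_cons_of_ne_nil h.ne_nil
    have hx : l.head h.ne_nil = x := by simp [hl]
    rw [hx]
    rw [hl] at hw
    rcases List.mem_cons.1 hw with rfl | hw
    · rfl
    · exfalso; exact h.tail_off_ring w (by rw [hl]; exact hw) hw1
  · rw [List.isChain_map]; exact h.chain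

/-- **THE THREE LEGS** for the template, in `Site 2` form: for a block pair `t_R ≤ t_D ≤ 3` and targets `a₁, a₂` (outer ring of `{w₀ ≤ t_R}`), `a₃` (in `{w₀ ≤ t_D}`,
off the centre and off `a₁, a₂`), not exceptional, and column sets `RP ⊇ {w₀ ≤ t_R} ∩ hexBall 0 3`, `D ⊇ {w₀ ≤ t_D} ∩ hexBall 0 3`: legs `ℓ₁, ℓ₂ ⊆ RP` to `a₁, a₂` and
`ℓ₃ ⊆ D` to `a₃` from three distinct inner-ring points, each avoiding the other two targets. [cite: DuminilCopinSidoraviciusTassion2016, §2.3 (proof of Fact 2)] -/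
theorem exists_legs {tR tD : ℕ} (hRD : tR ≤ tD) (hD : tD ≤ 3) {a1 a2 a3 : TriClaw.Pt} (h1 : TriClaw.tn a1 = 3) (h1t : a1.1 ≤ tR)
    (h2 : TriClaw.tn a2 = 3) (h2t : a2.1 ≤ tR) (h3 : TriClaw.tn a3 ≤ 3) (h3t : a3.1 ≤ tD) (h30 : a3 ≠ (0, 0)) (h31 : a3 ≠ a1) (h32 : a3 ≠ a2)
    (hexc : TriClaw.exceptional tR a1 a2 a3 = false) {RP D : Set (Site 2)} (hRP : ∀ w : TriClaw.Pt, TriClaw.tn w ≤ 3 → w.1 ≤ tR → TriClaw.toSite w ∈ RP)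
    (hDset : ∀ w : TriClaw.Pt, TriClaw.tn w ≤ 3 → w.1 ≤ tD → TriClaw.toSite w ∈ D) :
    ∃ (ρ₁ ρ₂ ρ₃ : Site 2) (ℓ₁ ℓ₂ ℓ₃ : List (Site 2)),
      Leg RP {q | q ≠ TriClaw.toSite a1 ∧ (q = TriClaw.toSite a2 ∨ q = TriClaw.toSite a3)} ρ₁ (TriClaw.toSite a1) ℓ₁ ∧
      Leg RP {q | q ≠ TriClaw.toSite a2 ∧ (q = TriClaw.toSite a1 ∨ q = TriClaw.toSite a3)} ρ₂ (TriClaw.toSite a2) ℓ₂ ∧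
      Leg D {q | q = TriClaw.toSite a1 ∨ q = TriClaw.toSite a2} ρ₃ (TriClaw.toSite a3) ℓ₃ ∧ ρ₁ ≠ ρ₂ ∧ ρ₃ ≠ ρ₁ ∧ ρ₃ ≠ ρ₂ := by
  obtain ⟨l1, l2, l3, H1, H2, H3, h12, h31, h32⟩ := TriClaw.exists_legs hRD hD h1 h1t h2 h2t h3 h3t h30 h31 h32 hexc
  have L1 := leg_of_legProps H1 hRP
  have L2 := leg_of_legProps H2 hRP
  have L3 := leg_of_legProps H3 hDset
  refine ⟨TriClaw.toSite (l1.head H1.ne_nil), TriClaw.toSite (l2.head H2.ne_nil), TriClaw.toSite (l3.head H3.ne_nil),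
    l1.map TriClaw.toSite, l2.map TriClaw.toSite, l3.map TriClaw.toSite, ?_, ?_, ?_, ?_, ?_, ?_⟩
  · refine ⟨L1.ne_nil, L1.head, L1.last, L1.ring, L1.mem, fun q hq hav => L1.not_avoid q hq ?_, L1.ne_zero, L1.ring_only, L1.chain, L1.nodup⟩
    obtain ⟨hne, h | h⟩ := hav
    · refine ⟨a2, ?_, h.symm⟩
      have : a2 ≠ a1 := fun e => hne (by rw [h, e])
      simp [this]
    · exact ⟨a3, by simp, h.symm⟩
  · refine ⟨L2.ne_nil, L2.head, L2.last, L2.ring, L2.mem, fun q hq hav => L2.not_avoid q hq ?_, L2.ne_zero, L2.ring_only, L2.chain, L2.nodup⟩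
    obtain ⟨hne, h | h⟩ := hav
    · refine ⟨a1, ?_, h.symm⟩
      have : a1 ≠ a2 := fun e => hne (by rw [h, e])
      simp [this]
    · exact ⟨a3, by simp, h.symm⟩
  · refine ⟨L3.ne_nil, L3.head, L3.last, L3.ring, L3.mem, fun q hq hav => L3.not_avoid q hq ?_, L3.ne_zero, L3.ring_only, L3.chain, L3.nodup⟩
    rcases hav with h | h
    · exact ⟨a1, by simp, h.symm⟩
    · exact ⟨a2, by simp, h.symm⟩
  · intro h
    apply h12
    rw [List.head?_eq_some_head H1.ne_nil, List.head?_eq_some_head H2.ne_nil, TriClaw.toSite_injective h]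
  · intro h
    apply h31
    rw [List.head?_eq_some_head H3.ne_nil, List.head?_eq_some_head H1.ne_nil, TriClaw.toSite_injective h]
  · intro h
    apply h32
    rw [List.head?_eq_some_head H3.ne_nil, List.head?_eq_some_head H2.ne_nil, TriClaw.toSite_injective h]

/-! ## §2 `RouteData` from two film paths -/

/-- **Routing data for the film's shadow from two film paths**: a self-avoiding path `L` from `E₁` to `E₂ ≠ E₁` over `RP` with a marked edge `c → y`, and a
self-avoiding path `CB` from `c` to `w'` with at least one edge, whose vertices after `c` lie over `D` and off `L`.
[cite: DuminilCopinSidoraviciusTassion2016, §2.3 (proof of Fact 2)] -/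
def routeData_of_paths {RP D : Set (Site 2)} {E₁ E₂ w' c y : triFilm k} {L CB l₁ l₂ : List (triFilm k)} (hL : FPath k L E₁ E₂) (hne : E₁ ≠ E₂)
    (hLRP : ∀ v ∈ L, ((v : triFilm k) : Site 2 × Site 1).1 ∈ RP) (hsplit : L = l₁ ++ c :: y :: l₂) (hCB : FPath k CB c w') (hCBne : CB.tail ≠ [])
    (hCBD : ∀ v ∈ CB.tail, ((v : triFilm k) : Site 2 × Site 1).1 ∈ D) (hdisj : ∀ v ∈ CB.tail, v ∉ L) : (hexShadow k).RouteData RP D E₁ E₂ w' where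
  P := L.tail.dropLast
  c := c
  y := y
  Br := CB.tail
  hP := fun x hx => hLRP x (List.mem_of_mem_tail (List.dropLast_subset _ hx))
  hchain := by rw [← hL.eq_cons_dropLast_concat hne]; exact hL.chain
  hnodup := by rw [← hL.eq_cons_dropLast_concat hne]; exact hL.nodup
  hy := ⟨l₁, l₂, by rw [← hL.eq_cons_dropLast_concat hne]; exact hsplit⟩
  hBr := hCBne
  hBrD := hCBD
  hBrchain := by
    have : c :: CB.tail = CB := by
      obtain ⟨x, xs, rfl⟩ := List.exists_cons_of_ne_nil hCB.ne_nil
      have hx : x = c := by simpa using hCB.head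
      rw [hx]; rfl
    rw [this]; exact hCB.chain
  hBrnodup := by
    have : c :: CB.tail = CB := by
      obtain ⟨x, xs, rfl⟩ := List.exists_cons_of_ne_nil hCB.ne_nil
      have hx : x = c := by simpa using hCB.head
      rw [hx]; rfl
    rw [this]; exact hCB.nodup
  hBrSP := fun x hx => by rw [← hL.eq_cons_dropLast_concat hne]; exact hdisj x hx
  hBrlast := by
    obtain ⟨x, xs, rfl⟩ := List.exists_cons_of_ne_nil hCB.ne_nil
    have hl := hCB.last
    change xs ≠ [] at hCBne
    rw [List.getLast?_cons, List.getLast?_eq_some_getLast hCBne] at hl  -- hmm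
    simpa using hl

/-- The successor of `routeData_of_paths`. [folklore] -/
@[simp] theorem routeData_of_paths_y {RP D : Set (Site 2)} {E₁ E₂ w' c y : triFilm k} {L CB l₁ l₂ : List (triFilm k)} (hL : FPath k L E₁ E₂) (hne : E₁ ≠ E₂)
    (hLRP : ∀ v ∈ L, ((v : triFilm k) : Site 2 × Site 1).1 ∈ RP) (hsplit : L = l₁ ++ c :: y :: l₂) (hCB : FPath k CB c w') (hCBne : CB.tail ≠ [])
    (hCBD : ∀ v ∈ CB.tail, ((v : triFilm k) : Site 2 × Site 1).1 ∈ D) (hdisj : ∀ v ∈ CB.tail, v ∉ L) :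
    (routeData_of_paths hL hne hLRP hsplit hCB hCBne hCBD hdisj).y = y := rfl

/-- The first branch vertex of `routeData_of_paths` is the second vertex of `CB`. [folklore] -/
theorem routeData_of_paths_b {RP D : Set (Site 2)} {E₁ E₂ w' c y : triFilm k} {L CB l₁ l₂ : List (triFilm k)} (hL : FPath k L E₁ E₂) (hne : E₁ ≠ E₂)
    (hLRP : ∀ v ∈ L, ((v : triFilm k) : Site 2 × Site 1).1 ∈ RP) (hsplit : L = l₁ ++ c :: y :: l₂) (hCB : FPath k CB c w') (hCBne : CB.tail ≠ [])
    (hCBD : ∀ v ∈ CB.tail, ((v : triFilm k) : Site 2 × Site 1).1 ∈ D) (hdisj : ∀ v ∈ CB.tail, v ∉ L) {b : triFilm k} {rest : List (triFilm k)}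
    (hCBeq : CB = c :: b :: rest) : (routeData_of_paths hL hne hLRP hsplit hCB hCBne hCBD hdisj).b = b := by
  simp [HexShadow.RouteData.b, routeData_of_paths, hCBeq]

/-! ## §3 The hub pieces -/

/-- **The hub piece of the rerouted path**: `(ρ, 1) → (0, 1) → (0, e) → (ρ', e)` for `e ∈ {0, 2}` and inner-ring points `ρ, ρ'`.
[cite: DuminilCopinSidoraviciusTassion2016, §2.3 (proof of Fact 2: the vertex z and its neighbours)] -/
theorem fpath_hubY (hk : 2 ≤ k) {ρ ρ' : Site 2} (hρ : triNorm ρ = 1) (hρ' : triNorm ρ' = 1) {e : ℕ} (he : e = 0 ∨ e = 2) :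
    FPath k [vx k ρ 1, vx k 0 1, vx k 0 e, vx k ρ' e] (vx k ρ 1) (vx k ρ' e) := by
  have hρ0 : ρ ≠ 0 := by rintro rfl; simp [triNorm] at hρ
  have hρ'0 : ρ' ≠ 0 := by rintro rfl; simp [triNorm] at hρ'
  have he1 : e ≠ 1 := by omega
  have hek : e ≤ k := by omega
  refine ⟨by simp, ?_, ?_, rfl, rfl⟩
  · refine List.isChain_cons_cons.2 ⟨?_, List.isChain_cons_cons.2 ⟨?_, List.isChain_cons_cons.2 ⟨?_, List.IsChain.singleton _⟩⟩⟩
    · exact (adj_vx_planar (triGraph_adj_zero_of_triNorm hρ) (by omega)).symm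
    · rcases he with rfl | rfl
      · exact (adj_vx_succ (k := k) 0 (j := 0) (by omega)).symm
      · exact adj_vx_succ (k := k) 0 (j := 1) (by omega)
    · exact adj_vx_planar (triGraph_adj_zero_of_triNorm hρ') hek
  · have h1k : 1 ≤ k := by omega
    have d01 : vx k ρ 1 ≠ vx k 0 1 := fun h => hρ0 ((vx_inj h1k h1k).1 h).1
    have d02 : vx k ρ 1 ≠ vx k 0 e := fun h => he1 ((vx_inj h1k hek).1 h).2.symm
    have d03 : vx k ρ 1 ≠ vx k ρ' e := fun h => he1 ((vx_inj h1k hek).1 h).2.symm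
    have d12 : vx k 0 1 ≠ vx k 0 e := fun h => he1 ((vx_inj h1k hek).1 h).2.symm
    have d13 : vx k 0 1 ≠ vx k ρ' e := fun h => he1 ((vx_inj h1k hek).1 h).2.symm
    have d23 : vx k 0 e ≠ vx k ρ' e := fun h => hρ'0 ((vx_inj hek hek).1 h).1.symm
    simp [d01, d02, d03, d12, d13, d23]

/-- **The hub piece of the branch**: `(0, 1) → (0, e) → (ρ, e)`. [cite: DuminilCopinSidoraviciusTassion2016, §2.3 (proof of Fact 2)] -/
theorem fpath_hubB (hk : 2 ≤ k) {ρ : Site 2} (hρ : triNorm ρ = 1) {e : ℕ} (he : e = 0 ∨ e = 2) :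
    FPath k [vx k 0 1, vx k 0 e, vx k ρ e] (vx k 0 1) (vx k ρ e) := by
  have hρ0 : ρ ≠ 0 := by rintro rfl; simp [triNorm] at hρ
  have he1 : e ≠ 1 := by omega
  have hek : e ≤ k := by omega
  refine ⟨by simp, ?_, ?_, rfl, rfl⟩
  · refine List.isChain_cons_cons.2 ⟨?_, List.isChain_cons_cons.2 ⟨?_, List.IsChain.singleton _⟩⟩
    · rcases he with rfl | rfl
      · exact (adj_vx_succ (k := k) 0 (j := 0) (by omega)).symm
      · exact adj_vx_succ (k := k) 0 (j := 1) (by omega)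
    · exact adj_vx_planar (triGraph_adj_zero_of_triNorm hρ) hek
  · have h1k : 1 ≤ k := by omega
    have d12 : vx k 0 1 ≠ vx k 0 e := fun h => he1 ((vx_inj h1k hek).1 h).2.symm
    have d13 : vx k 0 1 ≠ vx k ρ e := fun h => he1 ((vx_inj h1k hek).1 h).2.symm
    have d23 : vx k 0 e ≠ vx k ρ e := fun h => hρ0 ((vx_inj hek hek).1 h).1.symm
    simp [d12, d13, d23]

/-! ## §4 Auxiliary layers, the exceptional columns, small explicit paths -/

/-- The auxiliary layer of the second leg: `h₂`, unless `h₂ = h₁` (then `0` or `1`, whichever differs from `h₁`). [folklore] -/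
def lam2 (h₁ h₂ : ℕ) : ℕ := if h₂ = h₁ then (if h₁ = 0 then 1 else 0) else h₂

/-- `lam2 ≠ h₁`. [folklore] -/
theorem lam2_ne (h₁ h₂ : ℕ) : lam2 h₁ h₂ ≠ h₁ := by unfold lam2; split_ifs <;> omega

/-- `lam2 = h₂` when `h₂ ≠ h₁`. [folklore] -/
theorem lam2_eq {h₁ h₂ : ℕ} (h : h₂ ≠ h₁) : lam2 h₁ h₂ = h₂ := by unfold lam2; simp [h]

/-- `lam2 ≤ k`. [folklore] -/
theorem lam2_le {h₁ h₂ : ℕ} (hk : 1 ≤ k) (h2 : h₂ ≤ k) : lam2 h₁ h₂ ≤ k := by unfold lam2; split_ifs <;> omega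

/-- A layer among `{0,1,2}` different from two given ones. [folklore] -/
def fresh (x y : ℕ) : ℕ := if x ≠ 0 ∧ y ≠ 0 then 0 else if x ≠ 1 ∧ y ≠ 1 then 1 else 2

/-- `fresh x y ∉ {x, y}` and `fresh x y ≤ 2`. [folklore] -/
theorem fresh_spec (x y : ℕ) : fresh x y ≠ x ∧ fresh x y ≠ y ∧ fresh x y ≤ 2 := by unfold fresh; split_ifs <;> omega

/-- Membership in a glued path. [folklore] -/
theorem mem_trans_imp {l₁ l₂ : List (triFilm k)} {v : triFilm k} (h : v ∈ l₁ ++ l₂.tail) : v ∈ l₁ ∨ v ∈ l₂ := by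
  rcases List.mem_append.1 h with h | h
  · exact Or.inl h
  · exact Or.inr (List.mem_of_mem_tail h)

/-! ## The eight columns (and their mirror images) -/

/-- The corner `A`. [folklore] -/ def XA (m : Bool) : Pt := bif m then (0, -3) else (0, 3)
/-- Its outer-ring neighbour `B`. [folklore] -/ def XB (m : Bool) : Pt := bif m then (-1, -2) else (-1, 3)
/-- Its inner neighbour `C`. [folklore] -/ def XC (m : Bool) : Pt := bif m then (0, -2) else (0, 2)
/-- `D'`, adjacent to `B` and `C`. [folklore] -/ def XD (m : Bool) : Pt := bif m then (-1, -1) else (-1, 2)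
/-- `E`. [folklore] -/ def XE (m : Bool) : Pt := bif m then (-2, -1) else (-2, 3)
/-- `F`. [folklore] -/ def XF (m : Bool) : Pt := bif m then (-2, 0) else (-2, 2)
/-- `G`. [folklore] -/ def XG (m : Bool) : Pt := bif m then (-1, 0) else (-1, 1)
/-- `H`, adjacent to `G` and `C`. [folklore] -/ def XH (m : Bool) : Pt := bif m then (0, -1) else (0, 1)

/-- Adjacency in `𝕋` of two `toSite` points from the Boolean test. [folklore] -/
theorem adj_toSite {a b : Pt} (h : adjb a b = true) : triGraph.Adj (toSite a) (toSite b) := adjb_iff.1 h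

/-- An adjacent layer: towards `h₃` when `h₃ ≠ h`, else any. [folklore] -/
def adjLayer (k h h₃ : ℕ) : ℕ := if h < h₃ then h + 1 else if h₃ < h then h - 1 else if h < k then h + 1 else h - 1

/-- Properties of the adjacent layer (`k ≥ 2`). [folklore] -/
theorem adjLayer_spec (hk : 2 ≤ k) {h h₃ : ℕ} (hh : h ≤ k) (hh₃ : h₃ ≤ k) :
    adjLayer k h h₃ ≤ k ∧ (adjLayer k h h₃ = h + 1 ∨ h = adjLayer k h h₃ + 1) ∧
      (h₃ ≠ h → ¬(min (adjLayer k h h₃) h₃ ≤ h ∧ h ≤ max (adjLayer k h h₃) h₃)) := by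
  unfold adjLayer; split_ifs <;> omega

/-- An explicit three-vertex film path from adjacency and distinctness data. [folklore] -/
theorem fpath_three {u v w : triFilm k} (h₁ : (film k).Adj u v) (h₂ : (film k).Adj v w) (huw : u ≠ w) : FPath k [u, v, w] u w := by
  refine ⟨by simp, List.isChain_cons_cons.2 ⟨h₁, List.isChain_cons_cons.2 ⟨h₂, List.IsChain.singleton _⟩⟩, ?_, rfl, rfl⟩
  simp [h₁.ne, h₂.ne, huw]

/-- An explicit four-vertex film path from adjacency and distinctness data. [folklore] -/
theorem fpath_four {u v w x : triFilm k} (h₁ : (film k).Adj u v) (h₂ : (film k).Adj v w) (h₃ : (film k).Adj w x) (huw : u ≠ w) (hux : u ≠ x) (hvx : v ≠ x) :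
    FPath k [u, v, w, x] u x := by
  refine ⟨by simp, List.isChain_cons_cons.2 ⟨h₁, List.isChain_cons_cons.2 ⟨h₂, List.isChain_cons_cons.2 ⟨h₃, List.IsChain.singleton _⟩⟩⟩, ?_, rfl, rfl⟩
  simp [h₁.ne, h₂.ne, h₃.ne, huw, hux, hvx]

end TriFilm

end Summit.CriticalPhenomena.PercolationContinuityZ3.Theorems.Transplant

end
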